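import Summits.CriticalPhenomena.PercolationContinuityZ3.Theorems.PercNearOneGluingNoHeavyQuantGatedSliceMixLawCells
import Summits.CriticalPhenomena.PercolationContinuityZ3.Theorems.PercNearOneGluingNoHeavyQuantGatedSliceMixLawExchange
import Summits.CriticalPhenomena.PercolationContinuityZ3.Theorems.PercNearOneGluingNoHeavyQuantGatedSliceMixLawQAlone
import HarnessLib

/-!
# QUANT lane R8, T-DEC, leg (III), blob case — `LawDec.GatedSliceMixLaw'`, three of the typed Q-alone cells DISCHARGED: Q1 (no giant) and
# Q2 (`k₁` not a `t`-low) from arm-1 g41's `…QuantGatedSliceMixLawQAlone`, and the degenerate corner QD (`ℓ + k₂ ≤ t` forces the moved law to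
# be the point mass `δ_{k₂+a}`)

builds on p205010 (kernel theorem, internal audit signed; external expert review pending)

Support file (`--supports stmt-CriticalPhenomena-4575`), QUANT lane typer seat prim-quant-stmt (gen 30), rung R8 of
`run/shared/lean/prim/quant/LADDER.md`.  Memo `run/shared/lean/prim/quant/prim-quant-stmt-g30/MIXLAW-MIXTURES-G30.md` §6.  Theorems only,
standard axioms, no sorries.  Statements: `…QuantGatedSliceMixLawCells` (`MixLawCellQ1`, `MixLawCellQ2`, `MixLawCellQD`).

* **`LawDec.mixLawCellQ1_holds : MixLawCellQ1`** — arm-1's `mixLawQ_decAtT_of_top_le` (Theorem A at the moved law's own mean) in the cell binder.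
* **`LawDec.mixLawCellQ2_holds : MixLawCellQ2`** — arm-1's `mixLawQ_decAtT_of_noLow` (moment criterion): if `k₁` is not a `t`-low then none of
  `k₁, k₁+a, k₂, k₂+a` is (each would make `k₁` one), so the moved law has no nonzero low mass.
* **`LawDec.mixLawCellQD_holds : MixLawCellQD`** — from `S = (1−z)(k₁ + (k₂−k₁)λ) ≤ (1−z)k₂` and `k₁ + a + k₂ ≤ t ≤ S + a`: `k₁ = 0`, `z = 0`,
  `g = 1`, `S = k₂`, `λ = 1`; the moved law is `δ_{k₂+a}` with `2(k₂+a) ≥ t = k₂ + a` (`flowAtT_point` + `decAtT_of_flowAtT`).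
After this file the residual cells of `gatedSliceMixLaw'_of_cells` are Q3, Q4, Q4p, QH, QK (arm-1 / arm-2) and `MixLawRegimeB` (census-2).

[this work]; Q1/Q2 content: arm-1 g41 (`…QuantGatedSliceMixLawQAlone`), lead g30 (`gateCell_decAtT_of_noLow`).  The gluing rows served
[cite: KozmaNitzan2024, Conjecture 3 (p. 15)]; product measure [cite: Grimmett1999, §1.3 p. 10].
-/

noncomputable section

namespace Summit.CriticalPhenomena.PercolationContinuityZ3.Theorems

namespace Quant

open Finset

/-- the two-point law `{lo, hi; g}` (as in `…QuantLawDEC`) -/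
local notation3 "TP[" lo ", " hi ", " g ", " h "]" =>
  (g : ℝ) * (if (h : ℕ) = (hi : ℕ) then (1 : ℝ) else 0) + (1 - (g : ℝ)) * (if (h : ℕ) = (lo : ℕ) then (1 : ℝ) else 0)

namespace LawDec

/-- **CELL Q1 HOLDS** (`k₂ + a ≤ j`): arm-1's Theorem-A cell in the typed binder. [this work] -/
theorem mixLawCellQ1_holds : MixLawCellQ1 := by
  intro y z g S lam a j M k₁ k₂ hy0 hy1 hz0 hz1 hg1 hyg _ha _hjM _hS0 hta _hSj _hSM hk hk₂M hlam0 hlam1 hmean htop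
  have hg0 : 0 ≤ g := by nlinarith
  have h := mixLawQ_decAtT_of_top_le y z g lam a j M k₁ k₂ hy0.le hy1 hz0 hz1.le hg0 hg1 hyg hk hk₂M hlam0 hlam1
    (by rw [hmean]; exact hta) htop
  have ht : (1 - z) * ((k₁ : ℝ) + ((k₂ : ℝ) - k₁) * lam) + (a : ℝ) * g - z * (a : ℝ) * g = S + (a : ℝ) * g * (1 - z) := by
    rw [hmean]; ring
  rw [ht] at h
  exact h

/-- **CELL Q2 HOLDS** (`k₁` not a `t`-low): then no atom of the moved law other than `0` is a `t`-low, and arm-1's moment-criterion cell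
applies. [this work] -/
theorem mixLawCellQ2_holds : MixLawCellQ2 := by
  intro y z g S lam a j M k₁ k₂ hy0 hy1 hz0 hz1 hg1 hyg ha _hjM _hS0 hta _hSj _hSM hk hk₂M hlam0 hlam1 hmean hnot
  refine mixLawQ_decAtT_of_noLow y z g S lam a j M k₁ k₂ hy0 hy1 hz0 hz1 hg1 hyg ha hta hk hk₂M hlam0 hlam1 hmean ?_
  intro l hl1 hlj hlow
  rw [movedTwoPoint_apply]
  have hne : ∀ q : ℕ, k₁ ≤ q → l ≠ q := by
    intro q hq hlq
    subst hlq
    apply hnot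
    refine ⟨le_trans hq hlj, ?_⟩
    have : (k₁ : ℝ) ≤ l := by exact_mod_cast hq
    linarith
  rw [if_neg (by omega), if_neg (hne k₁ le_rfl), if_neg (hne (k₁ + a) (by omega)), if_neg (hne k₂ hk),
    if_neg (hne (k₂ + a) (by omega))]
  ring

/-- **CELL QD HOLDS** (the degenerate corner `ℓ + k₂ ≤ t` of `GatedSliceMixLaw'`): the moved law is the point mass at `k₂ + a`. [this work] -/
theorem mixLawCellQD_holds : MixLawCellQD := by
  intro y z g S lam a j M k₁ k₂ hy0 hy1 hz0 hz1 hg1 hyg ha hjM hS0 hta hSj hSM hk hk₂M hlam0 hlam1 hmean hdeg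
  classical
  have h1z : 0 < 1 - z := by linarith
  have hg0 : 0 < g := by nlinarith
  have ha0 : (0 : ℝ) ≤ a := Nat.cast_nonneg a
  have ha1 : (1 : ℝ) ≤ a := by exact_mod_cast ha
  have hk₁0 : (0 : ℝ) ≤ k₁ := Nat.cast_nonneg k₁
  have hk₂0 : (0 : ℝ) ≤ k₂ := Nat.cast_nonneg k₂
  have hkk : (k₁ : ℝ) ≤ k₂ := by exact_mod_cast hk
  push_cast at hdeg
  -- (1−z) k₂ ≥ S
  have hSk₂ : S ≤ (1 - z) * k₂ := by
    have : 0 ≤ (1 - z) * (((k₂ : ℝ) - k₁) * (1 - lam)) := mul_nonneg h1z.le (mul_nonneg (by linarith) (by linarith))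
    nlinarith
  have hagz : (a : ℝ) * g * (1 - z) ≤ a := by nlinarith [mul_nonneg ha0 hg0.le]
  -- k₁ = 0
  have hk₁z : (k₁ : ℝ) ≤ 0 := by nlinarith
  have hk₁e : k₁ = 0 := by exact_mod_cast le_antisymm hk₁z hk₁0
  subst hk₁e
  simp only [Nat.cast_zero, zero_add, sub_zero] at hdeg hmean hSk₂
  -- z k₂ = 0 and a (1 − g(1−z)) = 0 ⟹ z = 0, g = 1
  have hk₂pos : 0 < (k₂ : ℝ) := by nlinarith
  have hz : z = 0 := by
    have : z * k₂ ≤ 0 := by nlinarith [mul_nonneg ha0 hg0.le]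
    nlinarith
  subst hz
  have hg : g = 1 := by
    have : (a : ℝ) * (1 - g) ≤ 0 := by nlinarith
    nlinarith
  subst hg
  simp only [sub_zero, one_mul, mul_one] at hmean hdeg hSk₂
  have hSk : S = k₂ := le_antisymm hSk₂ (by linarith)
  have hlam : lam = 1 := by
    subst hSk; nlinarith
  subst hlam
  -- the moved law is δ_{k₂+a}
  have hP : (fun p : ℕ => (0 : ℝ) * (if p = 0 then (1 : ℝ) else 0) + (1 - 0) * slice (fun q => TP[0, k₂, (1 : ℝ), q]) a 1 p)
      = fun p => (1 : ℝ) * (if p = k₂ + a then (1 : ℝ) else 0) := by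
    funext p; rw [movedTwoPoint_apply]; ring
  rw [hP]
  refine decAtT_of_flowAtT y _ j (M + a) _ hy0 hy1 (fun p hp => by rw [if_neg (by omega)]; ring) ?_ ?_
  · have := sum_mul_indicator (fun _ => (1 : ℝ)) (M + a) (k₂ + a) (by omega)
    simpa using this
  · refine flowAtT_point y _ j (M + a) (k₂ + a) 1 (fun hc => ?_) zero_le_one
    have h2 := hc.2
    push_cast at h2
    linarith

end LawDec

end Quant

end Summit.CriticalPhenomena.PercolationContinuityZ3.Theorems
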